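import Summits.ABC.IUTFork.Cor312CheckBGluedRegions
import Summits.ABC.IUTFork.Cor312SoundInputSeparation
import Summits.ABC.IUTFork.ForkLocalGlobalWitness
import HarnessLib

/-!
# [IUTchIII] Cor. 3.12 — check (B): the gluing pair (b1) ∧ (b2) is STRICTLY STRONGER than the typed Corollary
# (kernel NON-EQUIVALENCE certificate (α) for the (G-UPSTREAM) candidate G-w5d155-1)

Record-only file (D-0012) of the abc-iut cell (wave-5 prover abc-iut-w5-d193, gen 2; written for
abc-iut-plan's ADJUDICATION-SPEC v2.1 §2 (G-UPSTREAM) item (α), INBOX 2026-08-26T01:26:54Z: «an admissible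
Setting where `Cor312.Setting.Statement` HOLDS and (b1)∧(b2) FAILS for every A, n′»). TAKES NO SIDE; proof-only
(no definition, no new `Prop` fact); every witness below is an INTERFACE-LEVEL toy of record already in the tree.

THE TWO CLAUSES (abc-iut-w5-d155, `Cor312CheckBGluedRegions` p415434, over abc-iut-c312-1's `Thm311ToCor312`):
* (b1) `ComputedBy P A` — the setting's (Ind3)-enlarged Θ-pilot region IS the output of a functorial region
  algorithm `A : RegionAlgorithm S` on the data of the setting's own column ([IUTchIII] Thm. 3.11 (i), kurims
  p. 154, «may be constructed via an algorithm … functorial with respect to isomorphisms of processions»);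
* (b2) `∀ j v_ℚ, P.qRegion j v_ℚ = A.ρ (S.D n′) j v_ℚ` — the q-pilot region is the output of THE SAME algorithm on
  the data of some column `n′` ((xi-a) p. 181 l. 33–44 read at REGION level through (iii)(a) pp. 156–157).
p415434 proves (b1) ∧ (b2) ∧ Thm. 3.11 (i) `MultiradialCompat` ⟹ Reading R3 ⟹ `Licence` ⟹ (under `BridgeHyps`) the
printed `Cor312.Setting.Statement`.

THIS FILE proves the CONVERSE FAILS at the interfaces, in the strongest admissible form the tree's witnesses allow:
* `not_gluedRegions_of_not_mem_possibleImages` — the general criterion (contrapositive of p415434's R3 lemma):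
  under `MultiradialCompat`, if at ONE packet the q-region is not a possible image of the Θ-pilot, then (b1) ∧ (b2)
  fails for EVERY region algorithm `A` and EVERY column `n′`;
* `sepSetting_not_gluedRegions` — at abc-iut-w5-d211's separating setting `SoundSeparation.sepSetting`
  (p414101) over Team A's `GapWitness.gapSituation` (p411346): typed Theorem 3.11 (i) ∧ (ii) ∧ (iii)
  (`gapFull_statement`), `BridgeHyps`, `AbsLogQPos` AND the typed Corollary (`sepSetting_statement`,
  `−|log(q)| = −2 ≤ −1 = −|log(Θ)|`) all HOLD, yet (b1) ∧ (b2) fails for every `A`, `n′` (Θ-region = the whole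
  ℚ-line packet, q-region = `{0}`, same data on every column);
* `sepSetting_computedBy`, `sepSetting_qGlued` — (b1) ALONE and (b2) ALONE are each satisfiable there (the
  constant-`univ`, resp. constant-`{0}`, region algorithm — both functorial), so the obstruction is exactly the
  SAME-ALGORITHM identification of the two pilot regions across the link, not either clause by itself;
* `statement_not_imp_gluedRegions` (∃-form, the shape of `GapWitness.thm311_bridgeHyps_not_imp_statement` and
  of `SoundSeparation.statement_not_imp_soundAtInput`) and `gluedRegions_not_iff_statement` — the packaged
  NON-EQUIVALENCE: at an instantiation where typed Thm. 3.11, the bridge hypotheses and `|log(q)| > 0` hold,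
  `¬ ((∃ A n′, (b1) ∧ (b2)) ↔ Cor312.Setting.Statement)`;
* `lgSetting_not_gluedRegions` — the same at the skeleton's local/global fork witness `LocalGlobal.lgSetting`
  (abc-iut-skel, `ForkLocalGlobalWitness` p412199: Statement ∧ BridgeHyps ∧ AbsLogQPos ∧ ¬R3), via the criterion.

READING FOR THE 12:30Z BLOCK (neutral). Together with p415434: over the frozen interfaces the (G-UPSTREAM)
candidate «(b1) ∧ (b2)» (GAP-LEDGER G-w5d155-1) sits STRICTLY between «nothing» and the typed Corollary —
sufficient (p415434) and NOT necessary (this file) — so it is NOT kernel-equivalent to the Corollary's inequality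
(contrast LEVEL 0 `GapGlobal`, `gapGlobal_iff_statement`). Its (G1′) flag is unchanged: the first consequence R3
is per-packet (w5-d155 R1). HONEST SCOPE: the separating settings are the ℚ-line / two-valued-log-volume toys of
record; nothing here says which side of the separation the intended model is on, and nothing asserts or denies
(b2) in print — that is referee lanes A1/A2's question. [claim: Mochizuki2012, status: disputed]
[cite: ScholzeStix2018, §2.2 pp. 9–10]
-/

namespace Summit.ABC.IUTFork

namespace Thm311ToCor312

open Thm311 Cor312 Cor312.Checks Cor312Vol Cor312Vol.GapWitness Cor312Vol.SoundSeparation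
  Cor312Vol.LocalGlobal

variable {T : ThetaIndex} {S : Situation T}

/-! ## 1. The criterion: (b1) ∧ (b2) forces Reading R3 at every packet -/

/-- **CRITERION.** Under Theorem 3.11 (i)'s multiradial compatibility, if at some packet the q-pilot region
is NOT a possible image of the Θ-pilot object, then the gluing pair (b1) ∧ (b2) fails for EVERY region
algorithm and EVERY column (contrapositive of abc-iut-w5-d155's `qRegion_mem_possibleImages_of_gluedRegions`).
[claim: Mochizuki2012, status: disputed] -/
theorem not_gluedRegions_of_not_mem_possibleImages (P : Setting S) (hS : S.MultiradialCompat)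
    {j : T.Label} {vQ : T.VQ} (h : P.qRegion j vQ ∉ P.possibleImages j vQ)
    (A : RegionAlgorithm S) (n' : ℤ) :
    ¬ (ComputedBy P A ∧ ∀ (j : T.Label) (vQ : T.VQ), P.qRegion j vQ = A.ρ (S.D n') j vQ) :=
  fun hglue => h (qRegion_mem_possibleImages_of_gluedRegions A P hS hglue.1 n' hglue.2 j vQ)

/-! ## 2. The separating setting of record: typed Thm 3.11, bridge hypotheses, `|log(q)| > 0`, Statement
TRUE — and no gluing pair -/

/-- The q-pilot region of the separating setting is `{0}` in every packet. [folklore] -/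
theorem sep_qRegion (j : toyIndex.Label) (vQ : toyIndex.VQ) : sepSetting.qRegion j vQ = {0} := rfl

/-- Every column of Team A's gap situation carries the same data `gapData`. [folklore] -/
theorem gapSituation_D (n : ℤ) : gapSituation.D n = gapData := rfl

/-- The q-pilot region `{0}` of the separating setting is NOT a possible image of the Θ-pilot object (those
are all the whole packet). [folklore] -/
theorem sep_qRegion_not_mem_possibleImages (j : toyIndex.Label) (vQ : toyIndex.VQ) :
    sepSetting.qRegion j vQ ∉ sepSetting.possibleImages j vQ := by
  intro h
  have e : sepSetting.qRegion j vQ = Set.univ := (sep_mem_possibleImages_iff j vQ _).mp h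
  exact univ_not_subset_zero j vQ (e.symm.subset.trans (sep_qRegion j vQ).subset)

/-- Team A's gap situation satisfies Theorem 3.11 (i)'s multiradial compatibility (a conjunct of
`gapFull_statement`). [folklore] -/
theorem gapSituation_multiradialCompat : gapSituation.MultiradialCompat := gap_partI.2.2

/-- **At the separating setting the gluing pair (b1) ∧ (b2) FAILS for every region algorithm `A` and every
column `n′`** — directly: (b1) makes `A.ρ gapData` the whole packet (the (Ind3)-enlarged Θ-region), (b2) makes
it `{0}` (the q-region), and the ℚ-line packet is nontrivial. [folklore] -/
theorem sepSetting_not_gluedRegions (A : RegionAlgorithm gapSituation) (n' : ℤ) :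
    ¬ (ComputedBy sepSetting A ∧
        ∀ (j : toyIndex.Label) (vQ : toyIndex.VQ), sepSetting.qRegion j vQ = A.ρ (gapSituation.D n') j vQ) :=
  not_gluedRegions_of_not_mem_possibleImages sepSetting gapSituation_multiradialCompat
    (sep_qRegion_not_mem_possibleImages (Setting.labelSucc ⟨0, by decide⟩) ()) A n'

/-- The same, by the direct computation (no use of multiradial compatibility: the data of all columns are
literally equal). [folklore] -/
theorem sepSetting_not_gluedRegions' (A : RegionAlgorithm gapSituation) (n' : ℤ) :
    ¬ (ComputedBy sepSetting A ∧
        ∀ (j : toyIndex.Label) (vQ : toyIndex.VQ), sepSetting.qRegion j vQ = A.ρ (gapSituation.D n') j vQ) := by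
  rintro ⟨hΘ, hq⟩
  -- both clauses evaluate `A.ρ` on the SAME data `gapData` (`gapSituation_D`), at the packet `(0, ())`
  have h1 : sepSetting.thetaRegion3 0 () = A.ρ gapData 0 () := hΘ 0 ()
  have h2 : sepSetting.qRegion 0 () = A.ρ gapData 0 () := hq 0 ()
  have e : sepSetting.thetaRegion3 0 () = sepSetting.qRegion 0 () := h1.trans h2.symm
  exact univ_not_subset_zero 0 ()
    ((sep_thetaRegion3 0 ()).symm.subset.trans (e.subset.trans (sep_qRegion 0 ()).subset))

/-- (b1) ALONE is satisfiable at the separating setting: the constant region algorithm `univ` (functorial: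
indeterminacies are bijections of the packets) computes its (Ind3)-enlarged Θ-region. [folklore] -/
theorem sepSetting_computedBy : ∃ A : RegionAlgorithm gapSituation, ComputedBy sepSetting A := by
  refine ⟨⟨fun _ _ _ => Set.univ, fun D Φ _ j vQ => ?_⟩, fun j vQ => sep_thetaRegion3 j vQ⟩
  exact (Set.image_univ_of_surjective (Φ j vQ).surjective).symm

/-- (b2) ALONE is satisfiable at the separating setting: the constant region algorithm `{0}` (functorial:
indeterminacies are linear) outputs its q-region on the data of any column. [folklore] -/
theorem sepSetting_qGlued : ∃ (A : RegionAlgorithm gapSituation) (n' : ℤ),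
    ∀ (j : toyIndex.Label) (vQ : toyIndex.VQ), sepSetting.qRegion j vQ = A.ρ (gapSituation.D n') j vQ := by
  refine ⟨⟨fun _ _ _ => {0}, fun D Φ _ j vQ => ?_⟩, 0, fun j vQ => sep_qRegion j vQ⟩
  ext x
  simp only [Set.mem_singleton_iff, Set.mem_image]
  constructor
  · rintro rfl
    exact ⟨0, rfl, map_zero _⟩
  · rintro ⟨y, rfl, rfl⟩
    exact map_zero _

/-- **NON-EQUIVALENCE CERTIFICATE (α), ∃-form.** There is an instantiation at which the typed Theorem 3.11
(i) ∧ (ii) ∧ (iii), every bridge hypothesis, `|log(q)| > 0` AND the typed Corollary 3.12 hold, (b1) alone and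
(b2) alone are each satisfiable, and the gluing pair (b1) ∧ (b2) fails for every region algorithm and every
column. With p415434 (pair ⟹ Statement): the pair is STRICTLY STRONGER than the Corollary at the frozen
interfaces. [folklore] -/
theorem statement_not_imp_gluedRegions :
    ∃ (T : ThetaIndex) (F : FullSituation T) (P : Setting F.toLatticeSituation.toSituation),
      F.Statement ∧ Cor312Vol.BridgeHyps P ∧ P.AbsLogQPos ∧
      Summit.ABC.IUTFork.Cor312.Setting.Statement P ∧
      (∃ A : RegionAlgorithm F.toLatticeSituation.toSituation, ComputedBy P A) ∧
      (∃ (A : RegionAlgorithm F.toLatticeSituation.toSituation) (n' : ℤ),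
        ∀ j vQ, P.qRegion j vQ = A.ρ (F.toLatticeSituation.toSituation.D n') j vQ) ∧
      ∀ (A : RegionAlgorithm F.toLatticeSituation.toSituation) (n' : ℤ),
        ¬ (ComputedBy P A ∧ ∀ j vQ, P.qRegion j vQ = A.ρ (F.toLatticeSituation.toSituation.D n') j vQ) :=
  ⟨toyIndex, gapFull, sepSetting, gapFull_statement, sepSetting_bridgeHyps, sepSetting_absLogQPos,
    sepSetting_statement, sepSetting_computedBy, sepSetting_qGlued, sepSetting_not_gluedRegions⟩

/-- **NON-EQUIVALENCE CERTIFICATE (α), `¬ ↔` form** (plan 01:26:54Z: «¬(GapA ↔ Statement) at some admissible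
setting»): at an instantiation with typed Thm. 3.11, the bridge hypotheses and `|log(q)| > 0`, the candidate gap
statement «∃ A n′, (b1) ∧ (b2)» is NOT equivalent to the typed Corollary. [folklore] -/
theorem gluedRegions_not_iff_statement :
    ∃ (T : ThetaIndex) (F : FullSituation T) (P : Setting F.toLatticeSituation.toSituation),
      F.Statement ∧ Cor312Vol.BridgeHyps P ∧ P.AbsLogQPos ∧
      ¬ ((∃ (A : RegionAlgorithm F.toLatticeSituation.toSituation) (n' : ℤ), ComputedBy P A ∧
            ∀ j vQ, P.qRegion j vQ = A.ρ (F.toLatticeSituation.toSituation.D n') j vQ) ↔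
          Summit.ABC.IUTFork.Cor312.Setting.Statement P) :=
  ⟨toyIndex, gapFull, sepSetting, gapFull_statement, sepSetting_bridgeHyps, sepSetting_absLogQPos,
    fun h => by
      obtain ⟨A, n', hglue⟩ := h.mpr sepSetting_statement
      exact sepSetting_not_gluedRegions A n' hglue⟩

/-! ## 3. Second witness: the skeleton's local/global fork setting -/

/-- The skeleton's local/global situation satisfies multiradial compatibility (same data on every column).
[folklore] -/
theorem lgSituation_multiradialCompat : lgSituation.MultiradialCompat := fun _ _ => rfl

/-- **At abc-iut-skel's local/global fork witness `lgSetting`** (p412199: the typed Corollary, `BridgeHyps`,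
`AbsLogQPos`, `RepresentedVol` hold while every per-packet reading — in particular R3 — fails), the gluing pair
(b1) ∧ (b2) fails for every region algorithm and every column. [folklore] -/
theorem lgSetting_not_gluedRegions (A : RegionAlgorithm lgSituation) (n' : ℤ) :
    ¬ (ComputedBy lgSetting A ∧
        ∀ (j : toyIndex.Label) (vQ : toyIndex.VQ), lgSetting.qRegion j vQ = A.ρ (lgSituation.D n') j vQ) := by
  obtain ⟨i, hi⟩ := not_forall.mp lg_not_qRegion_mem_possibleImages
  obtain ⟨vQ, h⟩ := not_forall.mp hi
  exact not_gluedRegions_of_not_mem_possibleImages lgSetting lgSituation_multiradialCompat h A n'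

/-- The second witness packaged: Statement ∧ BridgeHyps ∧ AbsLogQPos ∧ no gluing pair, at `lgSetting`.
[folklore] -/
theorem lgSetting_statement_and_not_gluedRegions :
    Summit.ABC.IUTFork.Cor312.Setting.Statement lgSetting ∧ Cor312Vol.BridgeHyps lgSetting ∧
      lgSetting.AbsLogQPos ∧
      ∀ (A : RegionAlgorithm lgSituation) (n' : ℤ),
        ¬ (ComputedBy lgSetting A ∧ ∀ j vQ, lgSetting.qRegion j vQ = A.ρ (lgSituation.D n') j vQ) :=
  ⟨lg_statement, lg_bridgeHyps, lg_absLogQPos, lgSetting_not_gluedRegions⟩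

end Thm311ToCor312

end Summit.ABC.IUTFork
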